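import Mathlib.RingTheory.Nilpotent.Defs
import Mathlib.RingTheory.DiscreteValuationRing.Basic
import Mathlib.Algebra.DualNumber
import Literature.Algebra.EuclideanDomain.EuclideanOrderTypeIndecomposable
import HarnessLib

/-!
# Local principal rings: the smallest algorithm is `θ(uπᵃ) = a + 1`, the Euclidean order type is the nilpotency index
# of `π` (Artinian case) or `ω` (discrete valuation rings) — Samuel 1971 §3 Remark (1), Clark 2015 Thm. 23

Topic `Literature/Algebra/EuclideanDomain`, namespace `Literature.Algebra.EuclideanDomain`.  THEOREMS ONLY (no `def`, no
instance, no named fact), all proved, in the vocabulary of `TransfiniteSmallestAlgorithm.lean` (`samuelSet R α = A_α`,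
`samuelRank = θ`) and `EuclideanOrderTypeIndecomposable.lean` (Euclidean order type `e(R) = ⨆ z, ((θ z − 1) + 1)`).

## Sources (read at the page)

* P. Samuel, *About Euclidean rings*, J. Algebra **19** (1971) 282–301 [Samuel1971] (materialised
  `paper:doi-10-1016-0021-8693-71-90110-4`), §3 Remark (1) (p. 286), VERBATIM: «A principal ideal ring is known to be a
  finite product of principal ideal domains and of principal ideal rings with a unique and nilpotent maximal ideal `Ap`
  ([11, Chap. IV, Sec. 15, Thm. 33]).  Every nonzero element `x` of such a ring can be written as `x = u p^{l(x)}`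
  (`u` : a unit), where `l(x)` is uniquely determined by `x`, so that `1 + l(x)` is an algorithm (as in Prop. 5), and the
  corresponding ring is Euclidean.  Thus the question as to whether a principal ideal ring is Euclidean boils down to the
  same question for principal ideal domains.»
* P. L. Clark, *A note on Euclidean order types*, Order **32** (2015) 157–178 [Clark2015EuclideanOrderTypes] (materialised
  `paper:arxiv-1208.0977`, arXiv numbering), §2.9 Theorem 23, VERBATIM: «a) (Samuel) Let `R` be a local principal ring with
  maximal ideal generated by `π`.  The map `φ : R → Ord` by `uπᵃ ↦ a` is a Euclidean function on `R`.  b) In fact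
  `φ = φ_R` is the bottom Euclidean function, hence: • If `R` is a domain, `e(R) = ω`. • If `R` is Artinian, then
  `e(R) = ℓ(R)`.»  Proof of a): «Let `x = u₁πᵃ ∈ R`, `y = u₂πᵇ ∈ R•`. If `b ≤ a` then `y ∣ x` and we may write
  `x = qy + 0`. If `b > a` we may write `x = 0·y + x`, and then `φ(x) < φ(y)`.»; of b): «`0 = φ_R(π⁰) < φ_R(π¹) < … <
  φ_R(πᵃ) < …`».

## Setting and what is formalised

As in both sources the structure is taken as the HYPOTHESIS «every nonzero `x` is `uπᵃ`, `u` a unit» (`hrep`) for a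
fixed non-unit `π` (`hπ`); no locality or chain condition is assumed beyond that (it follows: an element not divisible
by `π` is a unit, `LocalPrincipal.isUnit_of_not_dvd`).  Then:
* §1 `uπᵃ ∈ A_{a+1}` (Clark's division, `LocalPrincipal.mul_pow_mem_samuelSet`) and `uπᵃ ∈ A_k ⟹ a + 1 ≤ k` (the class of `πᵃ⁻¹…`:
  Clark's strict chain, `LocalPrincipal.succ_le_of_mul_pow_mem_samuelSet`), hence **`θ(uπᵃ) = a + 1`** for `uπᵃ ≠ 0`
  (**`LocalPrincipal.samuelRank_mul_pow`**; Samuel's «`1 + l(x)` is an algorithm», and it is the smallest one); every element lies in a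
  finite stage, so the ring is Euclidean for an ordinary algorithm (`LocalPrincipal.exists_euclideanFunction_of_forall_eq_mul_pow`).
* §2 the Euclidean order type: **`e(R) = ν`**, the nilpotency index of `π`, when `π` is nilpotent
  (**`LocalPrincipal.iSup_samuelRank_eq_nilpotencyClass`** — Clark's «`e(R) = ℓ(R)`», the length of an Artinian local principal ring
  being the nilpotency index of its maximal ideal), and **`e(R) = ω`** when it is not (`LocalPrincipal.iSup_samuelRank_eq_omega0_of_not_isNilpotent`).
* §3 instances: a discrete valuation ring (Mathlib `IsDiscreteValuationRing`, uniformizer `ϖ`): `θ(uϖᵃ) = a + 1` and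
  **`e(R) = ω`** (`IsDiscreteValuationRing.iSup_samuelRank_eq_omega0`; the value `θ = 1 + v` in Motzkin's language is
  `MinimalEuclideanFunctionDVR.lean`); the dual numbers `K[ε]` over a field: `θ(ε) = 2`, **`e(K[ε]) = 2`**
  (`DualNumber.iSup_samuelRank_eq_two`).
-- TODO(general form): the identification `ν = ℓ(R)` with `Module.length`, and the structure theorem for principal
-- ideal rings quoted by Samuel ([Zariski–Samuel, IV §15 Thm. 33]) are not formalised here.

## Mathlib / tree search

Mathlib: `nilpotencyClass` (`pow_nilpotencyClass`, `pow_pred_nilpotencyClass`, `pos_nilpotencyClass_iff`),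
`IsDiscreteValuationRing.exists_irreducible` / `eq_unit_mul_pow_irreducible`, `DualNumber` (`TrivSqZeroExt.isUnit_iff_isUnit_fst`,
`DualNumber.eps_mul_eps`); no Euclidean structure on local principal rings.  Tree: `TransfiniteSmallestAlgorithm.lean`
(`samuelRank_eq_iff`, `samuelSet_zero`, `exists_euclideanFunction_iff_iUnion_samuelSet_natCast`),
`EuclideanOrderTypeIndecomposable.lean` (`samuelRank_sub_one_lt_iSup`), `MinimalEuclideanFunctionDVR.lean` (DVR: `θ = 1 + v`
via `motzkinRank`), `SemilocalPIDEuclidean.lean` (Prop. 5 in general).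
-/

namespace Literature.Algebra.EuclideanDomain

universe u

open Ordinal

section LocalPrincipal

variable {R : Type u} [CommRing R] {π : R}

/-! ## §1 `θ(uπᵃ) = a + 1` -/

/-- In a ring all of whose non-zero elements are `uπᵃ` (`u` a unit, `π` a non-unit), an element not divisible by `π`
is a unit. [cite: Samuel1971, §3 Remark (1) (p. 286); Clark2015EuclideanOrderTypes, Thm. 23] -/
theorem LocalPrincipal.isUnit_of_not_dvd (hrep : ∀ x : R, x ≠ 0 → ∃ (a : ℕ) (u : R), IsUnit u ∧ x = u * π ^ a) {x : R}
    (hx : ¬π ∣ x) : IsUnit x := by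
  have hx0 : x ≠ 0 := fun h ↦ hx (h ▸ dvd_zero π)
  obtain ⟨a, u, hu, rfl⟩ := hrep x hx0
  cases a with
  | zero => simpa using hu
  | succ a => exact absurd (dvd_mul_of_dvd_right (dvd_pow_self π (Nat.succ_ne_zero a)) u) hx

/-- `1 − πt` is a unit (so `π` lies in the Jacobson radical: the ring is local with maximal ideal `(π)` as soon as
`π ≠ 0`). [cite: Samuel1971, §3 Remark (1) (p. 286); Clark2015EuclideanOrderTypes, Thm. 23] -/
theorem LocalPrincipal.isUnit_one_sub_mul (hπ : ¬IsUnit π)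
    (hrep : ∀ x : R, x ≠ 0 → ∃ (a : ℕ) (u : R), IsUnit u ∧ x = u * π ^ a) (t : R) : IsUnit (1 - π * t) :=
  LocalPrincipal.isUnit_of_not_dvd hrep fun h ↦ hπ (isUnit_of_dvd_one (by simpa using dvd_add h (dvd_mul_right π t)))

/-- **Clark's division (Thm. 23 a)), as membership in Samuel's stages: `uπᵃ ∈ A_{a+1}`** for a unit `u` with `uπᵃ ≠ 0` —
a class `x = vπᵇ` mod `uπᵃ` is `≡ 0` if `b ≥ a` («`y ∣ x`») and otherwise contains `x` itself, of smaller stage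
(«`x = 0·y + x`, and then `φ(x) < φ(y)`»). [cite: Clark2015EuclideanOrderTypes, Thm. 23 (a); Samuel1971, §3 Remark (1)
(p. 286)] -/
theorem LocalPrincipal.mul_pow_mem_samuelSet (hrep : ∀ x : R, x ≠ 0 → ∃ (a : ℕ) (u : R), IsUnit u ∧ x = u * π ^ a) :
    ∀ (a : ℕ) {u : R}, IsUnit u → u * π ^ a ∈ samuelSet R ((a + 1 : ℕ) : Ordinal.{u}) := by
  intro a
  induction a using Nat.strong_induction_on with
  | _ a ih =>
    intro u hu
    refine mem_samuelSet_of_forall fun x ↦ ?_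
    by_cases hx : x = 0
    · subst hx
      exact ⟨0, by exact_mod_cast Nat.succ_pos a, 0, zero_mem_samuelSet 0, by simp⟩
    · obtain ⟨b, v, hv, rfl⟩ := hrep x hx
      rcases le_or_gt a b with hab | hab
      · -- `b ≥ a`: `uπᵃ ∣ vπᵇ`, the class of `0`
        refine ⟨0, by exact_mod_cast Nat.succ_pos a, 0, zero_mem_samuelSet 0, ?_⟩
        rw [_root_.sub_zero]
        obtain ⟨w, hw⟩ := hu.exists_left_inv
        refine ⟨w * v * π ^ (b - a), ?_⟩
        calc v * π ^ b = (w * u) * v * (π ^ a * π ^ (b - a)) := by rw [hw, one_mul, ← pow_add, Nat.add_sub_cancel' hab]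
          _ = u * π ^ a * (w * v * π ^ (b - a)) := by ring
      · -- `b < a`: the class of `x = vπᵇ` itself, `vπᵇ ∈ A_{b+1}`, `b + 1 < a + 1`
        exact ⟨((b + 1 : ℕ) : Ordinal.{u}), by exact_mod_cast Nat.succ_lt_succ hab, v * π ^ b, ih b hab hv, by simp⟩

/-- **Clark's strict chain `0 = φ_R(π⁰) < φ_R(π¹) < …`, as a lower bound on stages: `uπᵃ ∈ A_k`, `uπᵃ ≠ 0 ⟹ a + 1 ≤ k`**
(`k` finite) — the class of `πᵃ⁻¹` mod `uπᵃ` consists of the elements `(1 − πut)πᵃ⁻¹ = wπᵃ⁻¹`, `w` a unit.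
[cite: Clark2015EuclideanOrderTypes, Thm. 23 (b); Samuel1971, §3 Remark (1) (p. 286)] -/
theorem LocalPrincipal.succ_le_of_mul_pow_mem_samuelSet (hπ : ¬IsUnit π)
    (hrep : ∀ x : R, x ≠ 0 → ∃ (a : ℕ) (u : R), IsUnit u ∧ x = u * π ^ a) :
    ∀ (a : ℕ) (k : ℕ) {u : R}, IsUnit u → u * π ^ a ≠ 0 → u * π ^ a ∈ samuelSet R (k : Ordinal.{u}) → a + 1 ≤ k := by
  intro a
  induction a with
  | zero =>
    intro k u _ h0 hmem
    by_contra hk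
    have hk0 : k = 0 := by omega
    subst hk0
    rw [Nat.cast_zero, samuelSet_zero] at hmem
    exact h0 hmem
  | succ a ih =>
    intro k u hu h0 hmem
    obtain ⟨β, hβ, r, hr, t, ht⟩ := forall_of_mem_samuelSet hmem h0 (π ^ a)
    obtain ⟨m, rfl⟩ := Ordinal.lt_omega0.1 (hβ.trans (Ordinal.natCast_lt_omega0 k))
    have hmk : m < k := by exact_mod_cast hβ
    -- `r = πᵃ − uπᵃ⁺¹t = (1 − π(ut)) πᵃ`
    have hr' : r = (1 - π * (u * t)) * π ^ a := by
      rw [pow_succ] at ht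
      linear_combination -ht
    have hw : IsUnit (1 - π * (u * t)) := LocalPrincipal.isUnit_one_sub_mul hπ hrep (u * t)
    have hπa : π ^ a ≠ 0 := fun h ↦ h0 (by rw [pow_succ, h, zero_mul, mul_zero])
    have hr0 : r ≠ 0 := by
      rw [hr']
      obtain ⟨w, hw'⟩ := hw.exists_left_inv
      intro h
      apply hπa
      calc π ^ a = w * ((1 - π * (u * t)) * π ^ a) := by rw [← mul_assoc, hw', one_mul]
        _ = 0 := by rw [h, mul_zero]
    rw [hr'] at hr hr0
    have := ih m hw hr0 hr
    omega

/-- **The smallest algorithm of a local principal ring: `θ(uπᵃ) = a + 1`** for a unit `u` with `uπᵃ ≠ 0` — Samuel's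
«`1 + l(x)` is an algorithm», which is moreover the smallest one (Clark: «`φ = φ_R` is the bottom Euclidean function»,
`φ_R = θ − 1`). [cite: Samuel1971, §3 Remark (1) (p. 286); Clark2015EuclideanOrderTypes, Thm. 23 (a), (b)] -/
theorem LocalPrincipal.samuelRank_mul_pow (hπ : ¬IsUnit π)
    (hrep : ∀ x : R, x ≠ 0 → ∃ (a : ℕ) (u : R), IsUnit u ∧ x = u * π ^ a) {u : R} (hu : IsUnit u) {a : ℕ}
    (h0 : u * π ^ a ≠ 0) : samuelRank (u * π ^ a) = ((a + 1 : ℕ) : Ordinal.{u}) := by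
  have hmem := LocalPrincipal.mul_pow_mem_samuelSet hrep a hu
  refine (samuelRank_eq_iff ⟨_, hmem⟩).2 ⟨hmem, fun β hβ hβm ↦ ?_⟩
  obtain ⟨m, rfl⟩ := Ordinal.lt_omega0.1 (hβ.trans (Ordinal.natCast_lt_omega0 _))
  have hm : m < a + 1 := by exact_mod_cast hβ
  have := LocalPrincipal.succ_le_of_mul_pow_mem_samuelSet hπ hrep a m hu h0 hβm
  omega

/-- In particular `θ(πᵃ) = a + 1` while `πᵃ ≠ 0`, and `θ(u) = 1`, `θ(π) = 2` (`π ≠ 0` is a universal side divisor).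
[cite: Clark2015EuclideanOrderTypes, Thm. 23 (b) («`0 = φ_R(π⁰) < φ_R(π¹) < …`»)] -/
theorem LocalPrincipal.samuelRank_pow (hπ : ¬IsUnit π)
    (hrep : ∀ x : R, x ≠ 0 → ∃ (a : ℕ) (u : R), IsUnit u ∧ x = u * π ^ a) {a : ℕ} (h0 : π ^ a ≠ 0) :
    samuelRank (π ^ a) = ((a + 1 : ℕ) : Ordinal.{u}) := by
  have := LocalPrincipal.samuelRank_mul_pow hπ hrep isUnit_one (a := a) (by rwa [one_mul])
  rwa [one_mul] at this

/-- Every element lies in a finite stage: `x = uπᵃ ∈ A_{a+1}`. [cite: Samuel1971, §3 Remark (1) (p. 286)] -/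
theorem LocalPrincipal.forall_exists_mem_samuelSet_natCast
    (hrep : ∀ x : R, x ≠ 0 → ∃ (a : ℕ) (u : R), IsUnit u ∧ x = u * π ^ a) :
    ∀ x : R, ∃ n : ℕ, x ∈ samuelSet R (n : Ordinal.{u}) := by
  intro x
  by_cases hx : x = 0
  · exact ⟨0, by rw [hx]; exact zero_mem_samuelSet _⟩
  · obtain ⟨a, u, hu, rfl⟩ := hrep x hx
    exact ⟨a + 1, LocalPrincipal.mul_pow_mem_samuelSet hrep a hu⟩

/-- Hence the ring is exhausted by its transfinite construction (already by the finite stages).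
[cite: Samuel1971, §3 Remark (1) (p. 286)] -/
theorem LocalPrincipal.forall_exists_mem_samuelSet_of_forall_eq_mul_pow
    (hrep : ∀ x : R, x ≠ 0 → ∃ (a : ℕ) (u : R), IsUnit u ∧ x = u * π ^ a) :
    ∀ x : R, ∃ α : Ordinal.{u}, x ∈ samuelSet R α :=
  fun x ↦ let ⟨n, hn⟩ := LocalPrincipal.forall_exists_mem_samuelSet_natCast hrep x; ⟨n, hn⟩

/-- **«… so that `1 + l(x)` is an algorithm … and the corresponding ring is Euclidean»**: an ordinary (`ℕ`-valued)
Euclidean function exists. [cite: Samuel1971, §3 Remark (1) (p. 286); Clark2015EuclideanOrderTypes, Thm. 23 (a)] -/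
theorem LocalPrincipal.exists_euclideanFunction_of_forall_eq_mul_pow
    (hrep : ∀ x : R, x ≠ 0 → ∃ (a : ℕ) (u : R), IsUnit u ∧ x = u * π ^ a) :
    ∃ φ : R → ℕ, ∀ a b : R, b ≠ 0 → ∃ q s : R, a = b * q + s ∧ (s = 0 ∨ φ s < φ b) :=
  exists_euclideanFunction_iff_iUnion_samuelSet_natCast.2 (Set.eq_univ_of_forall fun x ↦
    Set.mem_iUnion.2 (LocalPrincipal.forall_exists_mem_samuelSet_natCast hrep x))

/-! ## §2 The Euclidean order type: the nilpotency index of `π`, or `ω` -/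

/-- `(a + 1) − 1 + 1 = a + 1` in the ordinals (the summand of `e(R)` at an element of finite `θ = a + 1`). [folklore] -/
private theorem natCast_succ_sub_one_add_one (a : ℕ) :
    ((a + 1 : ℕ) : Ordinal.{u}) - 1 + 1 = ((a + 1 : ℕ) : Ordinal.{u}) := by
  have h : ((a + 1 : ℕ) : Ordinal.{u}) - 1 = (a : Ordinal.{u}) :=
    Ordinal.sub_eq_of_add_eq (by exact_mod_cast (show 1 + a = a + 1 by omega))
  rw [h]
  exact_mod_cast rfl

/-- **«If `R` is Artinian, then `e(R) = ℓ(R)`»**: when `π` is nilpotent, of nilpotency index `ν` (`π^ν = 0 ≠ π^{ν−1}`),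
the Euclidean order type is `e(R) = ν` — the values of `θ` are `0` and `a + 1` for `πᵃ ≠ 0`, i.e. `a < ν`.
[cite: Clark2015EuclideanOrderTypes, Thm. 23 (b); Samuel1971, §3 Remark (1) (p. 286)] -/
theorem LocalPrincipal.iSup_samuelRank_eq_nilpotencyClass [Nontrivial R] (hπ : ¬IsUnit π)
    (hrep : ∀ x : R, x ≠ 0 → ∃ (a : ℕ) (u : R), IsUnit u ∧ x = u * π ^ a) (hnil : IsNilpotent π) :
    (⨆ z : R, (samuelRank z - 1 + 1)) = (nilpotencyClass π : Ordinal.{u}) := by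
  set ν := nilpotencyClass π with hν
  have hνpos : 0 < ν := pos_nilpotencyClass_iff.2 hnil
  have hπν : π ^ ν = 0 := pow_nilpotencyClass hnil
  have hπν' : π ^ (ν - 1) ≠ 0 := pow_pred_nilpotencyClass hnil
  refine le_antisymm (Ordinal.iSup_le fun z ↦ ?_) ?_
  · by_cases hz : z = 0
    · subst hz
      rw [samuelRank_zero, Ordinal.zero_sub, zero_add]
      exact_mod_cast hνpos
    · obtain ⟨a, u, hu, rfl⟩ := hrep z hz
      have ha : a < ν := by
        by_contra h
        exact hz (by rw [← Nat.sub_add_cancel (not_lt.1 h), pow_add, hπν, mul_zero, mul_zero])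
      rw [LocalPrincipal.samuelRank_mul_pow hπ hrep hu hz, natCast_succ_sub_one_add_one]
      exact_mod_cast ha
  · have h := Ordinal.le_iSup (fun z : R ↦ samuelRank z - 1 + 1) (π ^ (ν - 1))
    rwa [LocalPrincipal.samuelRank_pow hπ hrep hπν', natCast_succ_sub_one_add_one, Nat.sub_add_cancel hνpos] at h

/-- **«If `R` is a domain, `e(R) = ω`»** — more generally whenever `π` is not nilpotent: `θ(πᵃ) = a + 1` for every `a`.
[cite: Clark2015EuclideanOrderTypes, Thm. 23 (b); Samuel1971, §3 Remark (1) (p. 286)] -/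
theorem LocalPrincipal.iSup_samuelRank_eq_omega0_of_not_isNilpotent (hπ : ¬IsUnit π)
    (hrep : ∀ x : R, x ≠ 0 → ∃ (a : ℕ) (u : R), IsUnit u ∧ x = u * π ^ a) (hnil : ¬IsNilpotent π) :
    (⨆ z : R, (samuelRank z - 1 + 1)) = ω := by
  have hpow : ∀ a : ℕ, π ^ a ≠ 0 := fun a h ↦ hnil ⟨a, h⟩
  refine le_antisymm (Ordinal.iSup_le fun z ↦ ?_) (Ordinal.omega0_le.2 fun n ↦ ?_)
  · by_cases hz : z = 0
    · subst hz
      rw [samuelRank_zero, Ordinal.zero_sub, zero_add]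
      exact Ordinal.one_lt_omega0.le
    · obtain ⟨a, u, hu, rfl⟩ := hrep z hz
      rw [LocalPrincipal.samuelRank_mul_pow hπ hrep hu hz, natCast_succ_sub_one_add_one]
      exact (Ordinal.natCast_lt_omega0 _).le
  · have h := Ordinal.le_iSup (fun z : R ↦ samuelRank z - 1 + 1) (π ^ n)
    rw [LocalPrincipal.samuelRank_pow hπ hrep (hpow n), natCast_succ_sub_one_add_one] at h
    exact le_trans (by exact_mod_cast Nat.le_succ n) h

end LocalPrincipal

/-! ## §3 Instances: discrete valuation rings (`e = ω`), dual numbers (`e = 2`) -/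

section Instances

/-- A discrete valuation ring with uniformizer `ϖ`: `θ(uϖᵃ) = a + 1` (Samuel's `1 + v`, cf. `MinimalEuclideanFunctionDVR.lean`
for the Motzkin-language version). [cite: Clark2015EuclideanOrderTypes, Thm. 23; Samuel1971, Prop. 5 Cor. (p. 285) and
§4 Example (3) (p. 290)] -/
theorem IsDiscreteValuationRing.samuelRank_mul_pow {R : Type u} [CommRing R] [IsDomain R] [IsDiscreteValuationRing R]
    {ϖ : R} (hϖ : Irreducible ϖ) {u : R} (hu : IsUnit u) (a : ℕ) :
    samuelRank (u * ϖ ^ a) = ((a + 1 : ℕ) : Ordinal.{u}) :=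
  LocalPrincipal.samuelRank_mul_pow hϖ.not_isUnit
    (fun _ hx ↦ let ⟨n, v, h⟩ := IsDiscreteValuationRing.eq_unit_mul_pow_irreducible hx hϖ; ⟨n, v, v.isUnit, h⟩) hu
    (mul_ne_zero hu.ne_zero (pow_ne_zero a hϖ.ne_zero))

/-- **«If `R` is a domain, `e(R) = ω`»: the Euclidean order type of a discrete valuation ring is `ω`.**
[cite: Clark2015EuclideanOrderTypes, Thm. 23 (b)] -/
theorem IsDiscreteValuationRing.iSup_samuelRank_eq_omega0 {R : Type u} [CommRing R] [IsDomain R]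
    [IsDiscreteValuationRing R] : (⨆ z : R, (samuelRank z - 1 + 1)) = ω := by
  obtain ⟨ϖ, hϖ⟩ := IsDiscreteValuationRing.exists_irreducible R
  refine LocalPrincipal.iSup_samuelRank_eq_omega0_of_not_isNilpotent hϖ.not_isUnit
    (fun _ hx ↦ let ⟨n, v, h⟩ := IsDiscreteValuationRing.eq_unit_mul_pow_irreducible hx hϖ; ⟨n, v, v.isUnit, h⟩)
    fun ⟨n, hn⟩ ↦ pow_ne_zero n hϖ.ne_zero hn

/-- The dual numbers `K[ε]` over a field: every non-zero element is `u εᵃ` with `a ≤ 1` (`x = x₀ + x₁ε` is a unit iff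
`x₀ ≠ 0`, and `x₁ε = x₁ · ε` with `x₁` a unit otherwise). [cite: Clark2015EuclideanOrderTypes, Thm. 23 (the Artinian
case, `ℓ = 2`)] -/
theorem DualNumber.exists_eq_mul_eps_pow {K : Type u} [Field K] (x : DualNumber K) (hx : x ≠ 0) :
    ∃ (a : ℕ) (u : DualNumber K), IsUnit u ∧ x = u * DualNumber.eps ^ a := by
  by_cases h0 : x.fst = 0
  · refine ⟨1, TrivSqZeroExt.inl x.snd, ?_, ?_⟩
    · rw [TrivSqZeroExt.isUnit_iff_isUnit_fst, TrivSqZeroExt.fst_inl]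
      refine isUnit_iff_ne_zero.2 fun h1 ↦ hx ?_
      exact TrivSqZeroExt.ext h0 h1
    · rw [pow_one]
      refine TrivSqZeroExt.ext ?_ ?_
      · simp [h0]
      · simp
  · exact ⟨0, x, TrivSqZeroExt.isUnit_iff_isUnit_fst.2 (isUnit_iff_ne_zero.2 h0), by rw [pow_zero, mul_one]⟩

/-- `ε` is not a unit and `ε² = 0 ≠ ε`: its nilpotency index is `2`. [cite: Clark2015EuclideanOrderTypes, Thm. 23] -/
theorem DualNumber.nilpotencyClass_eps {K : Type u} [Field K] : nilpotencyClass (DualNumber.eps : DualNumber K) = 2 := by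
  rw [nilpotencyClass_eq_succ_iff]
  refine ⟨by rw [pow_succ, pow_one, DualNumber.eps_mul_eps], fun h ↦ ?_⟩
  rw [pow_one] at h
  exact one_ne_zero (congrArg TrivSqZeroExt.snd h)

/-- **`θ(ε) = 2`**: `ε` is a universal side divisor of `K[ε]`. [cite: Clark2015EuclideanOrderTypes, Thm. 23 (b)] -/
theorem DualNumber.samuelRank_eps {K : Type u} [Field K] : samuelRank (DualNumber.eps : DualNumber K) = 2 := by
  have hε : ¬IsUnit (DualNumber.eps : DualNumber K) := by
    rw [TrivSqZeroExt.isUnit_iff_isUnit_fst]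
    simp
  have h := LocalPrincipal.samuelRank_pow hε DualNumber.exists_eq_mul_eps_pow (a := 1)
    (by rw [pow_one]; exact fun h ↦ one_ne_zero (congrArg TrivSqZeroExt.snd h))
  rw [pow_one] at h
  rw [h]
  norm_num

/-- **`e(K[ε]) = 2 = ℓ(K[ε])`**: the Artinian case of Clark's Thm. 23 (b) for the dual numbers.
[cite: Clark2015EuclideanOrderTypes, Thm. 23 (b)] -/
theorem DualNumber.iSup_samuelRank_eq_two {K : Type u} [Field K] :
    (⨆ z : DualNumber K, (samuelRank z - 1 + 1)) = 2 := by
  have hε : ¬IsUnit (DualNumber.eps : DualNumber K) := by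
    rw [TrivSqZeroExt.isUnit_iff_isUnit_fst]
    simp
  have h := LocalPrincipal.iSup_samuelRank_eq_nilpotencyClass hε DualNumber.exists_eq_mul_eps_pow
    ⟨2, by rw [pow_succ, pow_one, DualNumber.eps_mul_eps]⟩
  rw [h, DualNumber.nilpotencyClass_eps]
  norm_num

end Instances

end Literature.Algebra.EuclideanDomain
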